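import Literature.AlgebraicGeometry.Hironaka2017.WQWitness
import Mathlib.RingTheory.Valuation.Basic
import Mathlib.Algebra.CharP.Lemmas
import Mathlib.Algebra.Ring.GeomSum
import HarnessLib

/-!
# Barrier: riso-triviality (RV-metric arc data) is blind along a purely inseparable torus orbit of singular points
# («RisoBlindAlongInseparableOrbit»)

`Literature/Barriers/ResolutionOfSingularities/RisoBlindAlongInseparableOrbit.lean` — barrier catalogue entry (D-0021) for
the summit `ResolutionOfSingularities`, filed at the request of the LADDER-RESOLUTION cell `res-hironaka`
(director-resolution 2026-08-27T02:47:48Z, carver queue #4; finding of record = kill test K3.2′ variant (V-a) «riso-strata»,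
W2 run, seat res-L1-k32 g3, report `pub/res-hironaka/L/res-L1-k32/KILL-TEST-K3.2prime.md` §9 / ADDENDUM A2, sha16
`8c8ecf551575ca5b`, local check script `k32prime_va_w2_check.py`; director ruling 2026-08-27T02:39:05Z «W3.2 OF RECORD … clause 2
by K3.2′ (V-a) on W2: rtd(0) = rtd(P) = 0, pair not separated»). TECHNIQUE CLASS, in words: use the RISOMETRY TYPE of the
infinitesimal ball of Hahn-series arcs at a point — Monreal's riso-triviality space `rtsp_x(X) ⊆ T_xX` and dimension
`rtd_x(X)` [cite: Monreal2026, Def. 3.17 and Def. 4.7], the first shadow `S_d = {rtd = d}` of the riso-stratification of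
Bradley-Williams–Halupczok made embedding-free — as a CANONICAL FOCUSING DATUM or CENTRE RULE (blow up the closures of the
rtd-cuts of the singular locus; the printed Question 1.6, Summit-side route `RisoStrata`), expecting it to separate points
that finer resolution invariants separate and to supply regular centres.

## The phenomenon (what defeats it here)

Along a curve `Γ` of singular points that is a torus orbit with PURELY INSEPARABLE orbit map (all weights of the coordinates
non-zero along `Γ` divisible by `p`) the symmetry making the points of `Γ` alike has ZERO DIFFERENTIAL, and valuatively a torus
element `s ≡ 1` moves an arc strictly deeper than `v(s − 1)` (§1 `val_pow_sub_pow_lt`); the RV-class [cite: Monreal2026, Def. 3.9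
and Ex. 3.11] of the difference of two nearby arcs of `Γ` is carried by the `p`-prime coordinates alone (§1
`rv_blind_of_dvd_exponent`). The orbit direction — in characteristic `0` a product direction of the formal germ, hence
riso-trivial (Cor. 3.24 / Cor. 4.6) — is invisible to RV-data. On the cell's W-Q fourfold this yields `rtd = 0` at a generic
orbit point `P ∈ Γ₂` (where résumé-type invariants are SMALLER than at `0`) and at `0`: the lowest rtd-cut of `Sing` contains the
cuspidal curve `{0} ∪ Γ̄₂ = {w⁵ = z⁶}` — neither a regular centre nor a separator of `(0, P)` (cell's hand computation, below).

## What is PROVED here (kernel; `[folklore]` lemmas — nothing about risometries is asserted in Lean)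

§1 MECHANISM, every commutative ring `K` with a valuation `v` (Mathlib's multiplicative convention: `v ≤ 1` integral, SMALLER
= DEEPER; the source writes additively, p0009 L3): for a unit `μ₀`, an integral `μ₁` with `0 < v(μ₁ − μ₀) < 1`, `p ∤ a`, `p ∣ b`
(`CharP K p`): `v(μ₁ᵇ − μ₀ᵇ) ≤ v(μ₁ − μ₀)ᵖ < v(μ₁ − μ₀) = v(μ₁ᵃ − μ₀ᵃ)` (`RisoBlind.rv_blind_of_dvd_exponent`, from
`val_pow_sub_pow_eq` / `val_pow_sub_pow_lt`); W-Q instances `wq_gamma2_rv_blind` (orbit `(μ⁵, μ⁶)`), `wq_torus_moves_deeper`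
(weights `20, 24`). §2 SPECIMEN, every commutative ring `R` with `2 = 0` where stated, `fW` = `Literature.AlgebraicGeometry.
Hironaka2017.WQWitness.fW = x² + wv⁶ + zw⁵v² + yz²wv⁴ + yz³w⁵ + yz⁹ + y⁴zw²v² + y¹¹` on `𝔸⁵ = (x,y,z,w,v)` (torus weights
`(99,18,20,24,29)`, `WQWitness.torus_fW`): closed forms of the partials (`pderiv_one_fW`, …); `Γ₂ : μ ↦ (0,0,μ⁵,μ⁶,0) ⊂ {fW = 0}`
with all partials vanishing along it in characteristic `2` (`∂_y fW|Γ₂ = 2μ⁴⁵`) — `Γ₂ ⊂ Sing(fW, 2)`, `P = Γ₂(1) = (0,0,1,1,0)`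
(`gamma2_singular`, `P_singular`); Euler field of the torus at `P` `= (0,0,20,24,0) = 0` and `20 = 4·5`, `24 = 4·6`, `2 ∤ 5`,
`2 ∣ 6` (`eulerField_P_eq_zero`). §3 SPECIMEN, the gradient table of the cell's hand computation at `P` (identities in `R[t]`,
characteristic `2`): along `(y,z,w,v) = (0,1,1+t,0)`, `(t,1,1,0)`, `(0,1,1,t)` the gradient of `fW − x²` is `(t+t⁴+t⁵,0,0,0)`,
`(t¹⁰,0,t,0)`, `(t⁴,t²,t²+t⁶,0)` with values `0, t¹¹, t²+t⁶` (`grad_arcW/Y/V`); the leading vectors `(1,0,0,0)`, `(0,0,1,0)`,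
`(0,1,1,0)` have common kernel the `v`-axis (`kernels_inter`). Headline: `Monreal2026_risoBlindAlongInseparableOrbit`.

## What is QUOTED (printed statements consumed as premises by the cell's hand argument; risometries, Hahn-series arcs,
## `rtsp`/`rtd` are NOT formalised at Literature level)

V. Monreal, *Functorial stratifications of singularities in characteristic 0*, arXiv:2606.12554 (June 2026) [Monreal2026]; held
text `paper:arxiv-2606.12554` (LaTeX-source chunks p0001–p0027; «chunk pNNNN Lk» = lines of those chunks), read 2026-08-27:
* Def. 2.4 (p0007 L34–L39): `K/κ` admissible over a domain `R`: «`K` is an algebraically closed, spherically complete valued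
  field whose valuation ring … satisfies `O_K/𝔪 ≃ κ`, inducing a section of the residue map», `κ ⊇ Frac(R)`; §3 (p0009 L3):
  «admissible over a domain `R` (of arbitrary characteristic)».
* Def. 3.9 (p0009 L70–L75): «`α ∼_rv β ⟺` both arcs have the same base point and (`v(α,β) > v(α)`) ∨ (`α = β`)»; Ex. 3.11
  (p0010 L6–L14): on `𝔸ⁿ`, arcs based at the origin: «`α ∼_rv β ⟺ r_i ≡ r'_i mod I_{v(α)} ∀ i`».
* Def. 3.14 / 3.15 / 3.17, Rem. 3.16 (p0010 L57–L79): `W`-translation-invariance «`A + B_{W,0}(γ) = A`»; «a set-theoretic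
  bijection `φ : A → A'` is a risometry, if for every `a,b ∈ A`: `rv(φ(a) − φ(b)) = rv(a − b)`»; «`𝒜` is `W`-riso-trivial on
  `B`, if there exists a risometry `φ : supp(𝒜|_B) → C`, `C ⊂ B`, such that `φ(𝒜|_B)` is `W`-translation-invariant on `B` …
  `rtd_B(𝒜) := max dim_κ V`»; translations / compositions / inverses of risometries are risometries.
* Prop. 3.23 (p0012 L1–L14): `W`-riso-trivial on `B` iff for every `w ∈ π_W(B)` there is an adapted `W`-straightener
  `φ_w : supp(𝒜|_B) → (π_W|_{supp})⁻¹(w) + B_{W,w₀}(γ)`; Cor. 3.24 (p0012 L50–L53): `rtd_B(𝒜 × V^⊥) = rtd_{B|_V}(𝒜) + dim V^⊥`.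
* Cor. 4.3 (p0015 L43–L45): at a smooth point `rtd_B(B|_X) = dim X`; Def. 4.5 / Cor. 4.6 / Def. 4.7 (p0016 L7–L14, L16–L20,
  L44–L50): `rtsp_B ⊂ T_xX` canonically, invariant under isomorphisms of complete local rings; `rtsp_x(X) ⊂ T_xX` the maximal
  subspace with `rtsp_x(X) ×_k Spec κ = rtsp_{B_{X_κ,x}}(X_κ(O_K))` for every admissible `K/κ`, `rtd_x(X) := dim rtsp_x(X)`.
* Thm. 4.13 (p0018 L4–L9) = Thm. 1.2 (p0004 L20–L25), characteristic-free: «`C_x(X)(κ) + W(κ) = C_x(X)(κ)`» for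
  `W = rtsp_x(X)`, «`W ⊂ C_x(X)`», «`rtd_x(X) ≤ dim X`». Rem. 1.3 (p0004 L27–L28): constructibility of the level sets of `rtd`
  «unclear» in characteristic `p`; Question 1.6 (p0004 L40–L41): «Is it possible to resolve the singularities of a given
  `k`-scheme `X` by repeatedly blowing-up regular centers of the form `S_{≤d}(X/k)`?»; Questions 6.4 / 6.5 (p0025 L6–L7,
  L11–L12): openness of `rtd ≥ r`, `K`-independence of `rtsp` in arbitrary characteristic — OPEN.

## Application recorded here (cell res-hironaka, rung L, D-0089; HONEST FRAMING)

THE CELL'S HAND ARGUMENT (res-L1-k32 g3, report §9, lemmas L1–L3, §9.3–9.4; OURS, AI-level, NOT kernel-checked, NOT a printed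
result; the report names an independent second reader as the wanted check): `K = k((t^ℚ))`, `k = k̄ ⊇ 𝔽₂`, `X₂ = V(fW)`,
`B_X = X₂(O_K) ∩ B_ξ` = graph of `√(fW − x²)` over `𝔪_K⁴`. (L1) leading-vector sets `LV_S(a,μ)` are transported by risometries and
translations, so a `W`-straightener forces `W̄∖0 ⊆ LV` of the straightened set; (L2) singular arcs are characterised through `LV`
and a fixed ambient vector, so `W̄∖0 ⊆ LV_S(a,μ)` for every singular arc `a`; (L3) at a non-singular arc `a` with gradient
`ℓ_a = ∂(fW − x²)(r_a)`: `LV_{B_X}(a,μ) ⊆ k·e_x ⊕ Frob(ker ℓ̄_a)`. AT `P ∈ Γ₂`: §1/§2 here (orbit `(μ⁵,μ⁶)`, `2 ∣ 6`) give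
`LV_S = k^×e_z`, so (L2) ⇒ `W̄ ⊆ k·e_z`; §3 (three kernels meeting in `k·e_v`) and (L3) ⇒ `W̄ ⊆ ⟨e_x, e_v⟩`; hence `W̄ = 0`,
`rtd_P(X₂) = 0` (Thm. 4.13 only gives `≤ 2`: `C_P = V((x̄+v̄)² + ȳw̄)`, cell kit job j262193). AT `0`: branches `w`-axis
(`LV = k^×e_w`) and `Γ₂` (`LV = k^×e_z`) ⇒ `W̄ = 0`, `rtd_0(X₂) = 0`; by the torus `rtd ≡ 0` on `Γ₂∖0`. CONSEQUENCE recorded by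
the cell: the riso datum does NOT separate `0` from `P` although `Inv_0 = (5,4,2) = Inv_max > Inv_P` and `e_0 = 4 ≠ 2 = e_P`
(cell reports K3.2 / K3.2′ / K3.2″; Summit-side `…Theorems.CampaignW32.*`, p466457 / p473659 / p485247 / p485262, cited by name —
Literature does not import Summits); `Z_0 ⊇ {0} ∪ Γ̄₂` is not regular at `0`; verdict «(V-a) riso/rtd: DEAD on W2», director
2026-08-27T02:39:05Z. Internal computations quoted as provenance, not citations. H. Hironaka's 2017 manuscript [Hironaka2017]
is UNDER ADJUDICATION in that cell (D-0012); NOTHING here is a claim about it, about its `Inv`, or about resolution of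
singularities in characteristic `p`; nothing here is a verdict on Question 1.6 or on the characteristic-0 theory (Thm. 1.1).
AI transcription of a LaTeX source: check the compiled paper before signing anything that depends on exact wording.
Sibling entries (same kill test): `KolchinStrataPrimeToP` (variant (V-b)), `HSBlindToEdgeRank` (K3.2, HS door).

## UPDATE (v2 of this docstring, 2026-08-27; declarations unchanged) — the rtd-values are now KERNEL

Scope-caveat (b) below («risometries, arc balls, `rtsp`, `rtd` are NOT formalised …; `rtd_0 = rtd_P = 0` rest on the cell's hand
lemmas (L1)–(L3)») is CLOSED by three later files, which this file cannot import (they import it):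
* `Literature/AlgebraicGeometry/Resolution/RisoTriviality.lean` — Monreal's Def. 3.5/3.6/3.9 (via Ex. 3.11)/3.14/3.15/3.17 typed for
  one arc set of `𝔸ⁿ` over an arbitrary valued ring (`Riso.RvEq`, `Riso.IsRisometry`, `Riso.IsTranslationInvariantOn`,
  `Riso.IsRisoTrivialOn`, `Riso.rtd`), Lemma 3.10 and Rem. 3.16 proved;
* `Literature/AlgebraicGeometry/Hironaka2017/WQRisoArcs.lean` — the specimen near `P` (square-root arcs, gradient table, the
  singular arcs near `P`, `e_z`-dominance of the singular branch);
* `Literature/Barriers/ResolutionOfSingularities/RisoBlindAlongInseparableOrbitRtd.lean` — headlines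
  `Monreal2026_risoBlindAlongInseparableOrbit_rtdP` and `…_rtdBoth`: for EVERY perfect field `K` of characteristic `2`, EVERY
  non-trivial valuation and EVERY coefficient field `κ`, `rtd_{B_P}(X₂(K)) = rtd_{B_0}(X₂(K)) = 0` and no non-zero `κ`-subspace is
  a riso-triviality direction at `P` or at `0` (the cell's (L1)–(L3) re-derived and kernel-checked; the origin by a
  classification-free route); and `…/RisoBlindAlongInseparableOrbitRtdOrbit.lean` — `…_rtdGamma2`: the same at every arc-point
  `Γ₂(μ)`, `v(μ) ≤ 1`, of the orbit closure (torus transport).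
Accordingly the `status:` line of the headline below should be read as «mechanism + specimen + rtd-values kernel-certified»; the
only non-kernel inputs left in the `blocks:` clause are the cell's `Inv`-values (the manuscript's invariant AS TYPED by the cell —
a candidate under adjudication, never asserted) and the printed context (Thm. 4.13 etc., quoted, not used). -/

noncomputable section

namespace Literature.Barriers.ResolutionOfSingularities

open MvPolynomial
open Literature.AlgebraicGeometry.Hironaka2017.WQWitness

namespace RisoBlind

/-! ## §1 Mechanism: RV-blindness of a `p`-power coordinate along a monomial orbit (every valued ring of characteristic `p`) -/

section Valuation

open Finset

variable {K : Type*} [CommRing K] {Γ₀ : Type*} [LinearOrderedCommGroupWithZero Γ₀] (v : Valuation K Γ₀)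

/-- `v(n) ≤ 1` for every natural number `n` (ultrametric inequality). [folklore] -/
private theorem val_natCast_le_one (n : ℕ) : v (n : K) ≤ 1 := by
  induction n with
  | zero => simp
  | succ n ih =>
    rw [Nat.cast_succ]
    exact (v.map_add _ _).trans (max_le ih (by rw [v.map_one]))

/-- For integral `μ₀, μ₁` (`v ≤ 1`), `v(μ₁ⁿ − μ₀ⁿ) ≤ v(μ₁ − μ₀)`: the cofactor `Σ μ₁ⁱ μ₀ⁿ⁻¹⁻ⁱ` is integral. [folklore] -/
private theorem val_pow_sub_pow_le {μ₀ μ₁ : K} (h₀ : v μ₀ ≤ 1) (h₁ : v μ₁ ≤ 1) (n : ℕ) :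
    v (μ₁ ^ n - μ₀ ^ n) ≤ v (μ₁ - μ₀) := by
  rw [← geom_sum₂_mul, map_mul]
  have hS : v (∑ i ∈ range n, μ₁ ^ i * μ₀ ^ (n - 1 - i)) ≤ 1 :=
    v.map_sum_le fun i _ => by
      rw [map_mul, map_pow, map_pow]
      exact mul_le_one' (pow_le_one₀ zero_le h₁) (pow_le_one₀ zero_le h₀)
  simpa only [one_mul] using mul_le_mul' hS (le_refl (v (μ₁ - μ₀)))

/-- The cofactor `S = Σ_{i<a} μ₁ⁱ μ₀ᵃ⁻¹⁻ⁱ` of `μ₁ᵃ − μ₀ᵃ = (μ₁ − μ₀)·S` is a UNIT (`v S = 1`) when `μ₀` is a unit, `μ₁` is integral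
and close to `μ₀`, and `v(a) = 1` (e.g. `p ∤ a`): `S ≡ a·μ₀ᵃ⁻¹` modulo elements of valuation `< 1`. [folklore] -/
private theorem val_geomSum₂_eq_one {μ₀ μ₁ : K} (h₀ : v μ₀ = 1) (h₁ : v μ₁ ≤ 1) (hδ : v (μ₁ - μ₀) < 1)
    {a : ℕ} (ha : v (a : K) = 1) :
    v (∑ i ∈ range a, μ₁ ^ i * μ₀ ^ (a - 1 - i)) = 1 := by
  have hsplit : ∑ i ∈ range a, μ₁ ^ i * μ₀ ^ (a - 1 - i) =
      (a : K) * μ₀ ^ (a - 1) + ∑ i ∈ range a, (μ₁ ^ i - μ₀ ^ i) * μ₀ ^ (a - 1 - i) := by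
    have hconst : ∑ i ∈ range a, μ₀ ^ i * μ₀ ^ (a - 1 - i) = (a : K) * μ₀ ^ (a - 1) := by
      rw [Finset.sum_congr rfl fun i hi => ?_, sum_const, card_range, nsmul_eq_mul]
      rw [← pow_add]
      congr 1
      have := mem_range.mp hi
      omega
    rw [← hconst, ← sum_add_distrib]
    exact sum_congr rfl fun i _ => by ring
  have hlt : v (∑ i ∈ range a, (μ₁ ^ i - μ₀ ^ i) * μ₀ ^ (a - 1 - i)) < 1 :=
    v.map_sum_lt one_ne_zero fun i _ => by
      rw [map_mul, map_pow, h₀, one_pow, mul_one]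
      exact (val_pow_sub_pow_le v h₀.le h₁ i).trans_lt hδ
  have hmain : v ((a : K) * μ₀ ^ (a - 1)) = 1 := by
    rw [map_mul, map_pow, ha, h₀, one_pow, mul_one]
  rw [hsplit, v.map_add_eq_of_lt_left (by rw [hmain]; exact hlt), hmain]

/-- **Separable exponent.** If `v(a) = 1` then `v(μ₁ᵃ − μ₀ᵃ) = v(μ₁ − μ₀)` for a unit `μ₀` and an integral `μ₁` close to it:
the coordinate `μ ↦ μᵃ` of the orbit moves exactly as fast as the parameter. (derived here) [cite: Monreal2026, Def. 3.9 and Ex. 3.11] -/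
theorem val_pow_sub_pow_eq {μ₀ μ₁ : K} (h₀ : v μ₀ = 1) (h₁ : v μ₁ ≤ 1) (hδ : v (μ₁ - μ₀) < 1)
    {a : ℕ} (ha : v (a : K) = 1) : v (μ₁ ^ a - μ₀ ^ a) = v (μ₁ - μ₀) := by
  rw [← geom_sum₂_mul, map_mul, val_geomSum₂_eq_one v h₀ h₁ hδ ha, one_mul]

/-- **Inseparable exponent.** In characteristic `p`, if `p ∣ b` then `v(μ₁ᵇ − μ₀ᵇ) ≤ v(μ₁ − μ₀)ᵖ < v(μ₁ − μ₀)` for integral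
`μ₀, μ₁` with `0 < v(μ₁ − μ₀) < 1` (distinct for `v`, same residue): the `p`-power coordinate `μ ↦ μᵇ` of the orbit moves
STRICTLY DEEPER than the parameter, since `μ₁ᵇ − μ₀ᵇ = (μ₁^{b/p} − μ₀^{b/p})ᵖ`. (derived here) [cite: Monreal2026, Def. 3.9 and Ex. 3.11] -/
theorem val_pow_sub_pow_lt (p : ℕ) [Fact p.Prime] [CharP K p] {μ₀ μ₁ : K} (h₀ : v μ₀ ≤ 1) (h₁ : v μ₁ ≤ 1)
    (hδ : v (μ₁ - μ₀) < 1) (hδ0 : 0 < v (μ₁ - μ₀)) {b : ℕ} (hb : p ∣ b) :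
    v (μ₁ ^ b - μ₀ ^ b) < v (μ₁ - μ₀) := by
  obtain ⟨c, rfl⟩ := hb
  rw [mul_comm, pow_mul, pow_mul, ← sub_pow_char (μ₁ ^ c) (μ₀ ^ c), map_pow]
  exact (pow_le_pow_left₀ zero_le (val_pow_sub_pow_le v h₀ h₁ c) p).trans_lt
    (pow_lt_self_of_lt_one₀ hδ0 hδ (Fact.out : p.Prime).one_lt)

/-- `p ∤ a` makes `a` a unit for every valuation of a ring of characteristic `p` (`v(a) = 1`): `a·a' ≡ 1 (mod p)` for some
`a'`, so `(a : K)·(a' : K) = 1` with both factors of valuation `≤ 1`. [folklore] -/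
private theorem val_natCast_eq_one_of_not_dvd (p : ℕ) [Fact p.Prime] [CharP K p] {a : ℕ} (ha : ¬ p ∣ a) :
    v (a : K) = 1 := by
  have hp : p.Prime := Fact.out
  have hcop : Nat.Coprime a p := (Nat.Prime.coprime_iff_not_dvd hp).mpr ha |>.symm
  obtain ⟨m, -, hm⟩ := Nat.exists_mul_mod_eq_one_of_coprime hcop hp.one_lt
  have hprod : (a : K) * (m : K) = 1 := by
    have h := Nat.mod_add_div (a * m) p
    rw [hm] at h
    have : ((a * m : ℕ) : K) = ((1 + p * (a * m / p) : ℕ) : K) := by rw [h]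
    rw [Nat.cast_mul] at this
    simp [this]
  refine le_antisymm (val_natCast_le_one v a) (not_lt.mp fun h => ?_)
  have h2 : v (a : K) * v (m : K) ≤ v (a : K) * 1 := mul_le_mul' le_rfl (val_natCast_le_one v m)
  exact absurd ((by rwa [← map_mul, hprod, v.map_one, mul_one] at h2 : (1 : Γ₀) ≤ v (a : K)).trans_lt h) (lt_irrefl 1)

/-- **RV-BLINDNESS ALONG AN INSEPARABLY WEIGHTED ORBIT (mechanism; every valued ring of characteristic `p`).** On the orbit
`μ ↦ (μᵃ, μᵇ)`, `p ∤ a`, `p ∣ b`, two nearby arcs (`μ₀` a unit, `μ₁` integral, `0 < v(μ₁ − μ₀) < 1`) differ by a vector whose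
`b`-coordinate is STRICTLY DEEPER than its `a`-coordinate: `v(μ₁ᵇ − μ₀ᵇ) < v(μ₁ᵃ − μ₀ᵃ) = v(μ₁ − μ₀)` — read against Monreal's
Def. 3.9 / Ex. 3.11, the difference is rv-equivalent to its `a`-component: the inseparable coordinate is invisible. (derived here)
[cite: Monreal2026, Def. 3.9 and Ex. 3.11] -/
theorem rv_blind_of_dvd_exponent (p : ℕ) [Fact p.Prime] [CharP K p] {μ₀ μ₁ : K} (h₀ : v μ₀ = 1) (h₁ : v μ₁ ≤ 1)
    (hδ : v (μ₁ - μ₀) < 1) (hδ0 : 0 < v (μ₁ - μ₀)) {a b : ℕ} (ha : ¬ p ∣ a) (hb : p ∣ b) :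
    v (μ₁ ^ b - μ₀ ^ b) < v (μ₁ ^ a - μ₀ ^ a) ∧ v (μ₁ ^ a - μ₀ ^ a) = v (μ₁ - μ₀) := by
  have hea := val_pow_sub_pow_eq v h₀ h₁ hδ (val_natCast_eq_one_of_not_dvd v p ha)
  exact ⟨hea ▸ val_pow_sub_pow_lt v p h₀.le h₁ hδ hδ0 hb, hea⟩

/-- **W-Q instance: the curve `Γ₂ = {(0,0,μ⁵,μ⁶,0)}`, characteristic `2`.** Two nearby arcs of `μ ↦ (μ⁵, μ⁶)` based at a point
with unit coordinates differ by a vector whose `w`-coordinate (`μ⁶ = (μ³)²`) is strictly deeper than its `z`-coordinate (`μ⁵`),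
which moves exactly with the parameter: the RV-direction of `Γ₂` there is `e_z` (the cell's step §9.4 (i) at `P`). (derived here)
[cite: Monreal2026, Def. 3.9 and Ex. 3.11] -/
theorem wq_gamma2_rv_blind [CharP K 2] {μ₀ μ₁ : K} (h₀ : v μ₀ = 1) (h₁ : v μ₁ ≤ 1)
    (hδ : v (μ₁ - μ₀) < 1) (hδ0 : 0 < v (μ₁ - μ₀)) :
    v (μ₁ ^ 6 - μ₀ ^ 6) < v (μ₁ ^ 5 - μ₀ ^ 5) ∧ v (μ₁ ^ 5 - μ₀ ^ 5) = v (μ₁ - μ₀) :=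
  haveI : Fact (Nat.Prime 2) := ⟨Nat.prime_two⟩
  rv_blind_of_dvd_exponent v 2 h₀ h₁ hδ hδ0 (by decide) (by decide)

/-- **The torus moves `P` invisibly.** The torus of `WQWitness.torus_fW` has weights `20`, `24` (both even) on the non-zero
coordinates of `P = (0,0,1,1,0)`: for integral `s₀, s₁` with `0 < v(s₁ − s₀) < 1` both coordinates of `s₁·P − s₀·P` lie strictly
deeper than `v(s₁ − s₀)` — the valuative form of «the orbit map has zero differential» (`eulerField_P_eq_zero`). (derived here)
[cite: Monreal2026, Ex. 3.11 and Cor. 3.24] -/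
theorem wq_torus_moves_deeper [CharP K 2] {s₀ s₁ : K} (h₀ : v s₀ ≤ 1) (h₁ : v s₁ ≤ 1)
    (hδ : v (s₁ - s₀) < 1) (hδ0 : 0 < v (s₁ - s₀)) :
    v (s₁ ^ 20 - s₀ ^ 20) < v (s₁ - s₀) ∧ v (s₁ ^ 24 - s₀ ^ 24) < v (s₁ - s₀) :=
  haveI : Fact (Nat.Prime 2) := ⟨Nat.prime_two⟩
  ⟨val_pow_sub_pow_lt v 2 h₀ h₁ hδ hδ0 (by decide), val_pow_sub_pow_lt v 2 h₀ h₁ hδ hδ0 (by decide)⟩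

end Valuation

/-! ## §2 Specimen: the W-Q fourfold `X₂ = V(fW) ⊂ 𝔸⁵`, the orbit `Γ₂`, the point `P` -/

section Specimen

variable {R : Type*} [CommRing R]

/-- `∂fW/∂y = 11y¹⁰ + z⁹ + z³w⁵ + 4y³zw²v² + z²wv⁴` (any ring). [folklore] -/
private theorem pderiv_one_fW : pderiv 1 (fW : MvPolynomial (Fin 5) R) =
    11 * X 1 ^ 10 + X 2 ^ 9 + X 2 ^ 3 * X 3 ^ 5 + 4 * X 1 ^ 3 * X 2 * X 3 ^ 2 * X 4 ^ 2 + X 2 ^ 2 * X 3 * X 4 ^ 4 := by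
  simp [fW, pderiv_X, Fin.ext_iff]; ring

/-- `∂fW/∂z = 9yz⁸ + 3yz²w⁵ + y⁴w²v² + w⁵v² + 2yzwv⁴` (any ring). [folklore] -/
private theorem pderiv_two_fW : pderiv 2 (fW : MvPolynomial (Fin 5) R) =
    9 * X 1 * X 2 ^ 8 + 3 * X 1 * X 2 ^ 2 * X 3 ^ 5 + X 1 ^ 4 * X 3 ^ 2 * X 4 ^ 2 + X 3 ^ 5 * X 4 ^ 2
      + 2 * X 1 * X 2 * X 3 * X 4 ^ 4 := by
  simp [fW, pderiv_X, Fin.ext_iff]; ring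

/-- `∂fW/∂w = 5yz³w⁴ + 2y⁴zwv² + 5zw⁴v² + yz²v⁴ + v⁶` (any ring). [folklore] -/
private theorem pderiv_three_fW : pderiv 3 (fW : MvPolynomial (Fin 5) R) =
    5 * X 1 * X 2 ^ 3 * X 3 ^ 4 + 2 * X 1 ^ 4 * X 2 * X 3 * X 4 ^ 2 + 5 * X 2 * X 3 ^ 4 * X 4 ^ 2
      + X 1 * X 2 ^ 2 * X 4 ^ 4 + X 4 ^ 6 := by
  simp [fW, pderiv_X, Fin.ext_iff]; ring

/-- `∂fW/∂v = 2y⁴zw²v + 2zw⁵v + 4yz²wv³ + 6wv⁵` and `∂fW/∂x = 2x` (any ring). [folklore] -/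
private theorem pderiv_four_zero_fW : pderiv 4 (fW : MvPolynomial (Fin 5) R) =
      2 * X 1 ^ 4 * X 2 * X 3 ^ 2 * X 4 + 2 * X 2 * X 3 ^ 5 * X 4 + 4 * X 1 * X 2 ^ 2 * X 3 * X 4 ^ 3
        + 6 * X 3 * X 4 ^ 5 ∧
    pderiv 0 (fW : MvPolynomial (Fin 5) R) = 2 * X 0 := by
  constructor
  · simp [fW, pderiv_X, Fin.ext_iff]; ring
  · simp [fW, pderiv_X, Fin.ext_iff]

/-- The curve `Γ₂ : μ ↦ (0, 0, μ⁵, μ⁶, 0)` lies on `fW = 0` (any ring; closure `{x=y=v=0, w⁵ = z⁶}`) and, in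
characteristic `2`, all five partials vanish along it (`∂_y fW|Γ₂ = μ¹⁵μ³⁰ + μ⁴⁵ = 2μ⁴⁵`, the others `0`): every point of
`Γ₂` has order `≥ 2` for `fW`, `Γ₂ ⊂ Sing(fW, 2)` (re-derived at Literature level; the cell's Summit-side `gammaTwo_*`,
p466457, cited by name only). (derived here; `P`, `Γ₂` are NOT smooth points, so Cor. 4.3 does not apply and only Thm. 4.13's cone
bound constrains `rtsp` there) [cite: Monreal2026, Cor. 4.3 and Thm. 4.13] -/
theorem gamma2_singular (h2 : (2 : R) = 0) (μ : R) :
    eval ![0, 0, μ ^ 5, μ ^ 6, 0] (fW : MvPolynomial (Fin 5) R) = 0 ∧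
    ∀ i : Fin 5, eval ![0, 0, μ ^ 5, μ ^ 6, 0] (pderiv i (fW : MvPolynomial (Fin 5) R)) = 0 := by
  refine ⟨by simp [fW], fun i => ?_⟩
  fin_cases i
  · simp [pderiv_four_zero_fW.2]
  · have : eval ![0, 0, μ ^ 5, μ ^ 6, 0] (pderiv 1 (fW : MvPolynomial (Fin 5) R)) = 2 * μ ^ 45 := by
      rw [pderiv_one_fW]; simp; ring
    simpa [h2] using this
  · simp [pderiv_two_fW]
  · simp [pderiv_three_fW]
  · simp [pderiv_four_zero_fW.1]

/-- `P = Γ₂(1) = (0,0,1,1,0)` lies on `fW = 0` and, in characteristic `2`, is a singular point of `(fW, 2)` (elsewhere the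
linear part of `fW` at `P` is `2y ≠ 0`). (derived here) [cite: Monreal2026, Cor. 4.3 and Thm. 4.13] -/
theorem P_singular (h2 : (2 : R) = 0) :
    eval ![0, 0, 1, 1, 0] (fW : MvPolynomial (Fin 5) R) = 0 ∧
    ∀ i : Fin 5, eval ![0, 0, 1, 1, 0] (pderiv i (fW : MvPolynomial (Fin 5) R)) = 0 := by
  simpa using gamma2_singular (R := R) h2 1

/-- The torus of `WQWitness.torus_fW` has weights `(99, 18, 20, 24, 29)` on `(x,y,z,w,v)`; its infinitesimal generator (the
Euler field `Σ wᵢ xᵢ ∂ᵢ`) at `P = (0,0,1,1,0)` is `(0, 0, 20, 24, 0)`, which VANISHES in characteristic `2`: the orbit map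
`s ↦ s·P = (0,0,s²⁰,s²⁴,0)` has zero differential. The orbit weights there are `20 = 4·5`, `24 = 4·6` with `2 ∤ 5`, `2 ∣ 6`: modulo
the purely inseparable factor `s ↦ s⁴` the orbit `Γ₂∖0` is the monomial curve `μ ↦ (μ⁵, μ⁶)` of §1. (derived here; the product-direction
mechanism of Cor. 3.24 / Cor. 4.6 is what the vanishing differential withholds) [cite: Monreal2026, Cor. 3.24 and Cor. 4.6] -/
theorem eulerField_P_eq_zero (h2 : (2 : R) = 0) :
    (![(99 : R) * 0, 18 * 0, 20 * 1, 24 * 1, 29 * 0] : Fin 5 → R) = 0 ∧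
    (20 = 4 * 5 ∧ 24 = 4 * 6 ∧ ¬ 2 ∣ 5 ∧ 2 ∣ 6) := by
  have h20 : (20 : R) = 2 * 10 := by norm_num
  have h24 : (24 : R) = 2 * 12 := by norm_num
  refine ⟨?_, by decide⟩
  ext i; fin_cases i <;> simp [h20, h24, h2]

/-! ## §3 Specimen: the gradient table at the three non-singular arcs near `P` (the cell's step §9.4 (ii)) -/

/-- `(2 : R[t]) = 0` from `(2 : R) = 0`. [folklore] -/
private theorem two_eq_zero_poly (h2 : (2 : R) = 0) : (2 : Polynomial R) = 0 := by
  calc (2 : Polynomial R) = Polynomial.C (2 : R) := (map_ofNat Polynomial.C 2).symm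
    _ = 0 := by rw [h2, map_zero]

/-- Arc displaced from `P` in the `w`-direction, `(x; y,z,w,v) = (0; 0, 1, 1+t, 0)` (the `x`-slot is irrelevant for
`∂_y,…,∂_v fW`; with `x := 0`, `fW` evaluates to `G = fW − x²`), characteristic `2`: `G(r) = 0` and
`(∂_y, ∂_z, ∂_w, ∂_v)G(r) = (t + t⁴ + t⁵, 0, 0, 0)` — order `1`, leading vector `(1,0,0,0)`. (derived here; input of
the cell's fibrewise straightener argument over Prop. 3.23) [cite: Monreal2026, Prop. 3.23] -/
theorem grad_arcW (h2 : (2 : R) = 0) :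
    MvPolynomial.aeval (![0, 0, 1, 1 + Polynomial.X, 0] : Fin 5 → Polynomial R) (fW : MvPolynomial (Fin 5) R) = 0 ∧
    MvPolynomial.aeval (![0, 0, 1, 1 + Polynomial.X, 0] : Fin 5 → Polynomial R) (pderiv 1 (fW : MvPolynomial (Fin 5) R)) =
      Polynomial.X + Polynomial.X ^ 4 + Polynomial.X ^ 5 ∧
    MvPolynomial.aeval (![0, 0, 1, 1 + Polynomial.X, 0] : Fin 5 → Polynomial R) (pderiv 2 (fW : MvPolynomial (Fin 5) R)) = 0 ∧
    MvPolynomial.aeval (![0, 0, 1, 1 + Polynomial.X, 0] : Fin 5 → Polynomial R) (pderiv 3 (fW : MvPolynomial (Fin 5) R)) = 0 ∧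
    MvPolynomial.aeval (![0, 0, 1, 1 + Polynomial.X, 0] : Fin 5 → Polynomial R) (pderiv 4 (fW : MvPolynomial (Fin 5) R)) = 0 := by
  have e1 : MvPolynomial.aeval (![0, 0, 1, 1 + Polynomial.X, 0] : Fin 5 → Polynomial R) (pderiv 1 (fW : MvPolynomial (Fin 5) R)) =
      Polynomial.X + Polynomial.X ^ 4 + Polynomial.X ^ 5
      + 2 * (1 + 2 * Polynomial.X + 5 * Polynomial.X ^ 2 + 5 * Polynomial.X ^ 3 + 2 * Polynomial.X ^ 4) := by
    rw [pderiv_one_fW]; simp; ring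
  refine ⟨by simp [fW], by rw [e1, two_eq_zero_poly h2]; ring, by rw [pderiv_two_fW]; simp,
    by rw [pderiv_three_fW]; simp, by rw [pderiv_four_zero_fW.1]; simp⟩

/-- Arc displaced in the `y`-direction, `(0; t, 1, 1, 0)`, characteristic `2`: `G(r) = t¹¹` (so `x = t^{11/2}` in
`k((t^ℚ))`) and `(∂_y, ∂_z, ∂_w, ∂_v)G(r) = (t¹⁰, 0, t, 0)` — order `1`, leading vector `(0,0,1,0)`. (derived here)
[cite: Monreal2026, Prop. 3.23] -/
theorem grad_arcY (h2 : (2 : R) = 0) :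
    MvPolynomial.aeval (![0, Polynomial.X, 1, 1, 0] : Fin 5 → Polynomial R) (fW : MvPolynomial (Fin 5) R) = Polynomial.X ^ 11 ∧
    MvPolynomial.aeval (![0, Polynomial.X, 1, 1, 0] : Fin 5 → Polynomial R) (pderiv 1 (fW : MvPolynomial (Fin 5) R)) = Polynomial.X ^ 10 ∧
    MvPolynomial.aeval (![0, Polynomial.X, 1, 1, 0] : Fin 5 → Polynomial R) (pderiv 2 (fW : MvPolynomial (Fin 5) R)) = 0 ∧
    MvPolynomial.aeval (![0, Polynomial.X, 1, 1, 0] : Fin 5 → Polynomial R) (pderiv 3 (fW : MvPolynomial (Fin 5) R)) = Polynomial.X ∧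
    MvPolynomial.aeval (![0, Polynomial.X, 1, 1, 0] : Fin 5 → Polynomial R) (pderiv 4 (fW : MvPolynomial (Fin 5) R)) = 0 := by
  have e0 : MvPolynomial.aeval (![0, Polynomial.X, 1, 1, 0] : Fin 5 → Polynomial R) (fW : MvPolynomial (Fin 5) R) =
      Polynomial.X ^ 11 + 2 * Polynomial.X := by simp [fW]; ring
  have e1 : MvPolynomial.aeval (![0, Polynomial.X, 1, 1, 0] : Fin 5 → Polynomial R) (pderiv 1 (fW : MvPolynomial (Fin 5) R)) =
      Polynomial.X ^ 10 + 2 * (1 + 5 * Polynomial.X ^ 10) := by rw [pderiv_one_fW]; simp; ring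
  have e2 : MvPolynomial.aeval (![0, Polynomial.X, 1, 1, 0] : Fin 5 → Polynomial R) (pderiv 2 (fW : MvPolynomial (Fin 5) R)) =
      2 * (6 * Polynomial.X) := by rw [pderiv_two_fW]; simp; ring
  have e3 : MvPolynomial.aeval (![0, Polynomial.X, 1, 1, 0] : Fin 5 → Polynomial R) (pderiv 3 (fW : MvPolynomial (Fin 5) R)) =
      Polynomial.X + 2 * (2 * Polynomial.X) := by rw [pderiv_three_fW]; simp; ring
  refine ⟨by rw [e0, two_eq_zero_poly h2]; ring, by rw [e1, two_eq_zero_poly h2]; ring,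
    by rw [e2, two_eq_zero_poly h2]; ring, by rw [e3, two_eq_zero_poly h2]; ring, by rw [pderiv_four_zero_fW.1]; simp⟩

/-- Arc displaced in the `v`-direction, `(0; 0, 1, 1, t)`, characteristic `2`: `G(r) = t² + t⁶` and
`(∂_y, ∂_z, ∂_w, ∂_v)G(r) = (t⁴, t², t² + t⁶, 0)` — order `2`, leading vector `(0,1,1,0)`. (derived here)
[cite: Monreal2026, Prop. 3.23] -/
theorem grad_arcV (h2 : (2 : R) = 0) :
    MvPolynomial.aeval (![0, 0, 1, 1, Polynomial.X] : Fin 5 → Polynomial R) (fW : MvPolynomial (Fin 5) R) = Polynomial.X ^ 2 + Polynomial.X ^ 6 ∧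
    MvPolynomial.aeval (![0, 0, 1, 1, Polynomial.X] : Fin 5 → Polynomial R) (pderiv 1 (fW : MvPolynomial (Fin 5) R)) = Polynomial.X ^ 4 ∧
    MvPolynomial.aeval (![0, 0, 1, 1, Polynomial.X] : Fin 5 → Polynomial R) (pderiv 2 (fW : MvPolynomial (Fin 5) R)) = Polynomial.X ^ 2 ∧
    MvPolynomial.aeval (![0, 0, 1, 1, Polynomial.X] : Fin 5 → Polynomial R) (pderiv 3 (fW : MvPolynomial (Fin 5) R)) =
      Polynomial.X ^ 2 + Polynomial.X ^ 6 ∧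
    MvPolynomial.aeval (![0, 0, 1, 1, Polynomial.X] : Fin 5 → Polynomial R) (pderiv 4 (fW : MvPolynomial (Fin 5) R)) = 0 := by
  have e1 : MvPolynomial.aeval (![0, 0, 1, 1, Polynomial.X] : Fin 5 → Polynomial R) (pderiv 1 (fW : MvPolynomial (Fin 5) R)) =
      Polynomial.X ^ 4 + 2 * 1 := by rw [pderiv_one_fW]; simp; ring
  have e3 : MvPolynomial.aeval (![0, 0, 1, 1, Polynomial.X] : Fin 5 → Polynomial R) (pderiv 3 (fW : MvPolynomial (Fin 5) R)) =
      Polynomial.X ^ 2 + Polynomial.X ^ 6 + 2 * (2 * Polynomial.X ^ 2) := by rw [pderiv_three_fW]; simp; ring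
  have e4 : MvPolynomial.aeval (![0, 0, 1, 1, Polynomial.X] : Fin 5 → Polynomial R) (pderiv 4 (fW : MvPolynomial (Fin 5) R)) =
      2 * (3 * Polynomial.X ^ 5 + Polynomial.X) := by rw [pderiv_four_zero_fW.1]; simp; ring
  refine ⟨by simp [fW]; ring, by rw [e1, two_eq_zero_poly h2]; ring, by rw [pderiv_two_fW]; simp,
    by rw [e3, two_eq_zero_poly h2]; ring, by rw [e4, two_eq_zero_poly h2]; ring⟩

/-- The linear algebra of the cell's step §9.4 (ii): a vector `(c_y, c_z, c_w, c_v)` annihilated by the leading gradient vectors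
`(1,0,0,0)`, `(0,0,1,0)`, `(0,1,1,0)` lies on the `v`-axis (any ring; `c_z + c_w = 0` is `c_z = c_w` in characteristic `2`); with the
`x`-axis the three tangent spaces meet in `⟨e_x, e_v⟩`, which meets the `z`-axis of step (i) only in `0`. [folklore] -/
private theorem kernels_inter {k : Type*} [CommRing k] (c : Fin 4 → k)
    (h1 : c 0 = 0) (h2 : c 2 = 0) (h3 : c 1 + c 2 = 0) : c 0 = 0 ∧ c 1 = 0 ∧ c 2 = 0 := by
  exact ⟨h1, by rwa [h2, add_zero] at h3, h2⟩

end Specimen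

end RisoBlind

open RisoBlind

/-- **Barrier «RisoBlindAlongInseparableOrbit» — the kernel certificate.** (A) MECHANISM (every valued commutative ring of
characteristic `2`): nearby arcs of the orbit `μ ↦ (μ⁵, μ⁶)` differ by a vector whose `μ⁶`-coordinate is strictly deeper than its
`μ⁵`-coordinate, which moves exactly with the parameter (rv-equivalent to its `e_z`-component, Monreal Ex. 3.11; general form
`RisoBlind.rv_blind_of_dvd_exponent`), and the torus (weights `20, 24` at `P`) moves `P` strictly deeper than `v(s₁ − s₀)`.
(B) SPECIMEN (every commutative ring with `2 = 0`): `Γ₂ = (0,0,μ⁵,μ⁶,0)` consists of singular points of `(fW, 2)`, the Euler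
field of the torus (weights `99,18,20,24,29`) vanishes at `P = (0,0,1,1,0)`, the `w`-arc row of the gradient table of §3, and
the common kernel of the three leading gradient vectors is the `v`-axis (full table: `RisoBlind.grad_arcW/Y/V`).

Technique class, in prose: risometry / RV-metric (valued-field arc-ball) data at a point — riso-triviality spaces and
dimensions, first shadows `S_d`, t-stratification-type invariants — used as a canonical focusing datum or as the rule
selecting blow-up centres, expected to separate points that résumé-type invariants separate and to yield regular centres.

BARRIER (D-0021):
- technique_class: riso-stratification riso-triviality-dimension rv-metric-arc-balls hahn-series-arcs t-stratification first-shadow-centres canonical-stratum-as-centre inseparable-torus-orbit zero-differential-group-action positive-characteristic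
- blocks: every «the lowest rtd-cut (first shadow) of `Sing X` separates the points of maximal résumé / supplies a regular blow-up centre» claim on a variety carrying a curve `Γ` of singular points that is a torus orbit with PURELY INSEPARABLE orbit map (all weights on the coordinates non-zero along `Γ` divisible by `p`): the group symmetry along `Γ` has zero differential (certified instance: `RisoBlind.eulerField_P_eq_zero`, `wq_torus_moves_deeper`) and the RV-direction of `Γ` is carried by its `p`-prime coordinates only (`RisoBlind.rv_blind_of_dvd_exponent`; instance `wq_gamma2_rv_blind`), so nothing forces riso-triviality along `Γ`; on the W-Q fourfold (`fW`, characteristic `2`, `dim 4`) the cell's hand computation returns `rtd_P = 0` at the generic orbit point `P = (0,0,1,1,0)` AND `rtd_0 = 0`, hence (i) the riso datum does not separate `0` (résumé maximal, `Inv_0 = (5,4,2)`) from `P` (`Inv_P < Inv_0`; directrix `e_0 = 4 ≠ 2 = e_P`), (ii) the lowest rtd-cut `Z_0 ⊇ {0} ∪ Γ̄₂ = {x=y=v=0, w⁵ = z⁶}` is a cuspidal curve, not a regular centre — cell res-hironaka K3.2′ (V-a) W2 «DEAD», report `KILL-TEST-K3.2prime.md` 8c8ecf551575ca5b §9, director-resolution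 2026-08-27T02:39:05Z (internal computations quoted as provenance; Summit-side `…Theorems.CampaignW32.*` p466457 / p473659 / p485247 / p485262 cited by name).
- because: riso-triviality in a direction `W̄` needs, after a risometry, translation-invariance of the arc ball `A + B_{W,0}(γ) = A` (Def. 3.14 / 3.17), equivalently adapted straighteners onto every fibre of a projection to `W` (Prop. 3.23); the cell's lemmas (L1)–(L3) turn this into «`W̄∖0` lies in the leading-vector set of the singular arcs AND in every nearby non-singular arc's tangent space». Along an inseparable orbit the first set is spanned by the `p`-PRIME coordinates of the orbit (here `e_z`: `μ⁶ = (μ³)²` moves at doubled depth, §1), while the second is cut out by gradients that do not see the orbit (here `⟨e_x, e_v⟩`, §3) — the two requirements are incompatible, `W̄ = 0`. In characteristic `0` the same orbit would contribute a product direction of the complete local ring (a non-vanishing vector field integrates), and `rtd ≥ 1` along it by Cor. 3.24 / Cor. 4.6; the purely inseparable orbit map is exactly what removes this. The printed constraint Thm. 4.13 (`rtsp_x ⊆` translation-stabiliser of `C_x(X)`, `rtd ≤ dim X`) is consistent but not decisive (`≤ 4` at `0`, `≤ 2` at `P`).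
- evasions_known: (i) CHARACTERISTIC `0` / SEPARABLE ORBITS: where the orbit map is separable the symmetry differentiates to a non-zero vector field and riso-triviality along the orbit is expected (Thm. 1.1 regime; the same kill test found (V-a) ALIVE on the characteristic-3 witness W1, `rtd(O) = 0 < 1 = rtd(ξ_c)`, cell report §3) — the barrier is specific to `p | ` all orbit weights; (ii) PAIR THE RISO DATUM WITH CONE DATA (`H_X`, directrix `e`): variant (V-c) separates both cell pairs (Summit-side `CampaignW32.K32Prime.e_separates_W1/_W2`, cited by name) — though its top stratum is not regular at `0` on W2 either; (iii) HIGHER SHADOWS / TUPLES: Monreal's iterated shadow with `O_K`-tuples (Def. 3.8, §5) is finer than the first shadow `rtd`; nothing here is computed for it; (iv) FROBENIUS-AWARE RV-STRUCTURES: replace the additive RV-quotient by one that records `p`-th-power classes (so that `μ⁶ = (μ³)²` is «seen») — not in the source; (v) allow SINGULAR or positive-dimensional non-regular centres / weighted blow-ups (the author's own remark after Q. 1.6, McQuillan) — then (ii) of «blocks» is not an objection, (i) remains.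
- scope_caveats: (a) the source fixes an ADMISSIBLE extension `K/κ` (Def. 2.4: `K` algebraically closed, spherically complete, residue field `κ` algebraically closed) over a domain of arbitrary characteristic; `K`-independence of `rtsp` (Q. 6.5) and constructibility / openness of the rtd-level sets (Rem. 1.3, Q. 6.4) are OPEN in characteristic `p` — the cell's route fixes `K = k((t^ℚ))`; (b) risometries, arc balls, `rtsp`, `rtd` are NOT formalised at Literature level: the values `rtd_0 = rtd_P = 0` rest on the cell's hand lemmas (L1)–(L3) (OURS, AI-level, second reader wanted — NOT a printed theorem and NOT kernel-checked); the kernel content here is §1 (a theorem about valuations, proved for all valued rings of characteristic `p`) and the polynomial certificates §2–§3 that are the INPUTS of that hand computation; (c) `2 = 0` is used exactly for: the vanishing of `∂_y fW` on `Γ₂` and at `P`, the Euler field at `P`, the gradient table; `fW(Γ₂) = 0` holds over every ring; (d) the tangent cones (`in_0 fW = x̄²`: `WQWitness.fW_sub_sq_mem`; `in_P fW = (x̄+v̄)² + ȳw̄`: cell kit job j262193, not re-certified here) enter only through Thm. 4.13's non-decisive bound; (e) NOTHING here bears on Monreal's characteristic-0 theorems, on Question 1.6 in general, on the existence of resolution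 of singularities in positive characteristic, or on H. Hironaka's 2017 manuscript (under adjudication, D-0012): the Inv-values quoted are the cell's kernel computations with the manuscript's invariant AS TYPED by the cell (a candidate statement under adjudication, never asserted).
- status: established as a kernel-certified MECHANISM + SPECIMEN (§1–§3 proved in the stated generality) carrying a HAND-ARGUED application (rtd-values: cell report, second reader wanted); printed definitions / theorems quoted with chunk locators from the held text
[cite: Monreal2026, Def. 3.9, Ex. 3.11, Def. 3.14–3.17, Prop. 3.23, Cor. 3.24, Cor. 4.3, Cor. 4.6, Def. 4.7, Thm. 4.13, Q. 1.6, Q. 6.4–6.5] -/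
theorem Monreal2026_risoBlindAlongInseparableOrbit :
    -- (A) mechanism, every valued ring of characteristic 2: orbit (μ⁵, μ⁶) and torus weights (20, 24)
    (∀ (K : Type*) [CommRing K] [CharP K 2] (Γ₀ : Type*) [LinearOrderedCommGroupWithZero Γ₀] (v : Valuation K Γ₀)
        (μ₀ μ₁ : K), v μ₀ = 1 → v μ₁ ≤ 1 → v (μ₁ - μ₀) < 1 → 0 < v (μ₁ - μ₀) →
        (v (μ₁ ^ 6 - μ₀ ^ 6) < v (μ₁ ^ 5 - μ₀ ^ 5) ∧ v (μ₁ ^ 5 - μ₀ ^ 5) = v (μ₁ - μ₀)) ∧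
        (v (μ₁ ^ 20 - μ₀ ^ 20) < v (μ₁ - μ₀) ∧ v (μ₁ ^ 24 - μ₀ ^ 24) < v (μ₁ - μ₀))) ∧
    -- (B) specimen, every commutative ring with 2 = 0: Γ₂ ⊂ X₂ ∩ Sing(fW, 2); the Euler field of the torus vanishes
    --     at P = Γ₂(1); the w-arc row of the gradient table; the three leading vectors' common kernel is the v-axis
    (∀ (R : Type*) [CommRing R], (2 : R) = 0 →
      (∀ μ : R, eval ![0, 0, μ ^ 5, μ ^ 6, 0] (fW : MvPolynomial (Fin 5) R) = 0 ∧
        ∀ i : Fin 5, eval ![0, 0, μ ^ 5, μ ^ 6, 0] (pderiv i (fW : MvPolynomial (Fin 5) R)) = 0) ∧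
      (![(99 : R) * 0, 18 * 0, 20 * 1, 24 * 1, 29 * 0] : Fin 5 → R) = 0 ∧
      (MvPolynomial.aeval (![0, 0, 1, 1 + Polynomial.X, 0] : Fin 5 → Polynomial R) (pderiv 1 (fW : MvPolynomial (Fin 5) R)) =
          Polynomial.X + Polynomial.X ^ 4 + Polynomial.X ^ 5 ∧
        MvPolynomial.aeval (![0, 0, 1, 1 + Polynomial.X, 0] : Fin 5 → Polynomial R) (pderiv 2 (fW : MvPolynomial (Fin 5) R)) = 0 ∧
        MvPolynomial.aeval (![0, 0, 1, 1 + Polynomial.X, 0] : Fin 5 → Polynomial R) (pderiv 3 (fW : MvPolynomial (Fin 5) R)) = 0 ∧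
        MvPolynomial.aeval (![0, 0, 1, 1 + Polynomial.X, 0] : Fin 5 → Polynomial R) (pderiv 4 (fW : MvPolynomial (Fin 5) R)) = 0) ∧
      (∀ c : Fin 4 → R, c 0 = 0 → c 2 = 0 → c 1 + c 2 = 0 → c 0 = 0 ∧ c 1 = 0 ∧ c 2 = 0)) :=
  ⟨fun _ _ _ _ _ v _ _ h₀ h₁ hδ hδ0 => ⟨wq_gamma2_rv_blind v h₀ h₁ hδ hδ0, wq_torus_moves_deeper v h₀.le h₁ hδ hδ0⟩,
    fun _ _ h2 => ⟨gamma2_singular h2, (eulerField_P_eq_zero h2).1, (grad_arcW h2).2, fun c => kernels_inter c⟩⟩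

end Literature.Barriers.ResolutionOfSingularities
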